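import Summits.QuantumFields.YangMills.Theses.LuscherReduction
import Summits.QuantumFields.YangMills.Theorems.LuscherReductionRunningReductionTraceFormula

/-!
# Support `TraceFormula` (route `LuscherReduction`, item stmt-QuantumFields-20202) — CLOSED

The RED-split child `TraceFormula` (owner ym-beyond-p1 g19, route rev 11/12; `rfl`-equal to the registered
«KTR» rev-8 stub statement `TT.Stmt.stub_traceFormula`) is, character for character, the closed form
`TT.traceFormula_all` proved in `Theorems/LuscherReductionRunningReductionTraceFormula.lean` (p510667):
for `β ≥ 1` and `T ≥ 2` the zero-flux min–max transfer values `λ_k(L,β) = levelValue su2Rep L β k` have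
`Σ_k λ_k^T = Z_phys(L,β,T) = TT.physTrace L β T` (as a `HasSum`), the trace of the `T`-th power of the
Hilbert–Schmidt compression `P K_β P` written as the closed kernel chain with one physical average.

`traceFormula_proof : Summit.QuantumFields.YangMills.Theses.LuscherReduction.TraceFormula` — unconditional,
sorry-free, no new definitions, no named-fact hypotheses.

HONEST FRAMING: fixed-lattice (`L³` femto torus, any `L`) spectral bookkeeping of the femto rung R2b1;
no RG statement, no window, nothing infinite-volume, not a mass gap, not Clay.
-/

noncomputable section

namespace Summit.QuantumFields.YangMills.Theorems.FemtoTransferGap.TT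

/-- ★ **Support `TraceFormula`, closed**: the route decl `Theses.LuscherReduction.TraceFormula`
(`∀ L [NeZero L] β T, 1 ≤ β → 2 ≤ T → HasSum (fun k => levelValue su2Rep L β k ^ T) (TT.physTrace L β T)`)
is `TT.traceFormula_all`. [cite: ReedSimonIV1978, Thm. XIII.1] [cite: MontvayMunster1994, (3.145)] -/
theorem traceFormula_proof : Summit.QuantumFields.YangMills.Theses.LuscherReduction.TraceFormula := by
  unfold Summit.QuantumFields.YangMills.Theses.LuscherReduction.TraceFormula
  exact traceFormula_all

end Summit.QuantumFields.YangMills.Theorems.FemtoTransferGap.TT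

end
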